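import Literature.Computability.MetaComplexity.AffineSystemFreeness
import Literature.Computability.MetaComplexity.BlockCanonicalClosure
import Literature.Computability.MetaComplexity.BlockClosure
import HarnessLib

/-!
# Freeness outside a maximiser of the block deficiency (`ℕ`-indexed form): every maximiser — in particular the canonical closure — is a block closure in pivot form

`BlockClosure.lean` proves (`exists_blockClosure`) that every linear system `F` over `𝔽₂` in the
variables `x·a + j` has SOME set of blocks `Q` and pivots `p` with `BlockFree a F Q p` (every
assignment can be modified, keeping every form of `F` and every block of `Q`, to take arbitrary
bits at all non-pivot positions outside `Q`). Here the same is proved for EVERY MAXIMISER `Q` of the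
deficiency `deficiency a ⟨L(F)⟩` of `BlockCanonicalClosure.lean` (`blockFree_of_isMaxDef`), hence for
the CANONICAL closure `canClosure a ⟨L(F)⟩` (`exists_blockFree_canClosure`) — which is what the
Prover–Delayer strategy of Efremenko–Garlík–Itsykson's Theorem 5.8 needs (the potential counts the
canonical closure). Proof: transport to the window of the first `M` blocks exactly as in
`exists_blockClosure`, where the `ℕ`-indexed block rank `gRank` becomes the window deficiency of
`AffineSystemFreeness.lean` (the restriction map is injective on `⟨L(F)⟩` and matches the coordinate
subspaces block by block), then `AffSys.exists_free_of_isMax`.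

## References

* K. Efremenko, M. Garlík, D. Itsykson, STOC 2024, Thm 3.1, §4 [EfremenkoGarlikItsykson2024].
* Y. Alekseev, D. Itsykson, STOC 2025, §2.5, Lemma 2.9 [AlekseevItsykson2025].
-/

namespace Literature.Computability.MetaComplexity

open _root_.Computability Complexity Finset Module

/-! ### Window helpers (local copies, as in `BlockClosure.lean`) -/

/-- A linear form restricted to the window `{0, …, n-1}` (local copy). [folklore] -/
private def formWinF (n : ℕ) (f : Finset ℕ) : Fin n → ZMod 2 := fun v => if (v : ℕ) ∈ f then 1 else 0

/-- Extension by zero from the window to `ℕ` (local copy). [folklore] -/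
private def extWinF (n : ℕ) (z : Fin n → ZMod 2) : ℕ → ZMod 2 :=
  fun v => if h : v < n then z ⟨v, h⟩ else 0

/-- The pairing of a restricted form with a window vector is the parity sum of the form (local copy).
[folklore] -/
private theorem formWinF_dotProduct {n : ℕ} {f : Finset ℕ} (hf : ∀ i ∈ f, i < n) (z : ℕ → ZMod 2) :
    formWinF n f ⬝ᵥ (fun v : Fin n => z v) = ∑ i ∈ f, z i := by
  unfold dotProduct formWinF
  have h1 : ∑ v : Fin n, (if (v : ℕ) ∈ f then (1 : ZMod 2) else 0) * z v =
      ∑ v : Fin n, (fun i : ℕ => if i ∈ f then z i else 0) v :=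
    Finset.sum_congr rfl fun v _ => by by_cases hv : (v : ℕ) ∈ f <;> simp [hv]
  rw [h1, Fin.sum_univ_eq_sum_range (fun i : ℕ => if i ∈ f then z i else 0) n,
    Finset.sum_ite_mem]
  have hfr : Finset.range n ∩ f = f :=
    Finset.inter_eq_right.2 fun i hi => Finset.mem_range.2 (hf i hi)
  rw [hfr]

/-- The block of the variable `x·a + j` is `x` (local copy). [folklore] -/
private theorem blk_div' {a x j : ℕ} (ha : 0 < a) (hj : j < a) : (x * a + j) / a = x := by
  rw [Nat.add_comm, Nat.add_mul_div_right _ _ ha, Nat.div_eq_of_lt hj, zero_add]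

/-- The position of the variable `x·a + j` is `j` (local copy). [folklore] -/
private theorem blk_mod' {a x j : ℕ} (hj : j < a) : (x * a + j) % a = j := by
  rw [Nat.add_comm, Nat.add_mul_mod_self_right, Nat.mod_eq_of_lt hj]

/-! ### The form span of a system is supported in its blocks -/

/-- The span `⟨L(F)⟩` of the forms of a system is supported in the blocks below `M` as soon as every
variable of `F` is below `M·a`. [folklore] -/
theorem span_forms_le_coordSub {a M : ℕ} (ha : 0 < a) {F : Finset LinLit}
    (hvar : ∀ e ∈ F, ∀ v ∈ e.1, v < M * a) :
    Submodule.span (ZMod 2) (LinClause.forms F) ≤ coordSub (blockVars a (Finset.range M)) := by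
  rw [Submodule.span_le]
  intro w hw
  obtain ⟨e, he, rfl⟩ := LinClause.mem_forms_iff.1 hw
  intro i hi
  rw [mem_blockVars ha, Finset.mem_range, Nat.div_lt_iff_lt_mul ha] at hi
  have : i ∉ e.1 := fun h => hi (hvar e he i h)
  simp [linFormVec, this]

/-! ### Freeness outside any maximiser -/

/-- **Every maximiser of the deficiency is a block closure in pivot form** [Efremenko–Garlík–Itsykson
2024, Thm 3.1 / §4; Alekseev–Itsykson 2025, Lemma 2.9]: if `Q` maximises
`deficiency a ⟨L(F)⟩`, there are pivots `p` with `BlockFree a F Q p`. (Transport to the window of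
the first `M` blocks as in `exists_blockClosure`, then `AffSys.exists_free_of_isMax`.)
[cite: EfremenkoGarlikItsykson2024, Thm 3.1] -/
theorem blockFree_of_isMaxDef {a : ℕ} (ha : 0 < a) (F : Finset LinLit) {Q : Finset ℕ}
    (hQ : IsMaxDef a (Submodule.span (ZMod 2) (LinClause.forms F)) Q) :
    ∃ p : ℕ → Fin a, BlockFree a F Q p := by
  classical
  -- ### the window: the first `M` blocks, `M` past every block met by `F`
  set M : ℕ := (F.biUnion (fun e => e.1)).sup (fun v => v / a) + 1 with hM
  set n : ℕ := M * a with hn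
  have hvarM : ∀ e ∈ F, ∀ v ∈ e.1, v / a < M := by
    intro e he v hv
    exact Nat.lt_succ_of_le (Finset.le_sup (f := fun v => v / a) (Finset.mem_biUnion.2 ⟨e, he, hv⟩))
  have hblock_lt : ∀ x j : ℕ, x < M → j < a → x * a + j < n := by
    intro x j hx hj
    calc x * a + j < x * a + a := by omega
      _ = (x + 1) * a := by ring
      _ ≤ M * a := Nat.mul_le_mul_right a hx
  have hvarn : ∀ e ∈ F, ∀ v ∈ e.1, v < n := by
    intro e he v hv
    have h1 := hvarM e he v hv
    have h2 : v = v / a * a + v % a := (Nat.div_add_mod' v a).symm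
    rw [h2]
    exact hblock_lt _ _ h1 (Nat.mod_lt v ha)
  set W : Submodule (ZMod 2) (ℕ → ZMod 2) := Submodule.span (ZMod 2) (LinClause.forms F) with hW
  haveI : Module.Finite (ZMod 2) W := Module.Finite.span_of_finite (ZMod 2) (Set.finite_range _)
  have hWsupp : W ≤ coordSub (blockVars a (Finset.range M)) := span_forms_le_coordSub ha hvarn
  have hWn : ∀ w ∈ W, ∀ v, n ≤ v → w v = 0 := by
    intro w hw v hv
    apply hWsupp hw v
    rw [mem_blockVars ha, Finset.mem_range, Nat.div_lt_iff_lt_mul ha]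
    omega
  have hQM : Q ⊆ Finset.range M := hQ.subset_support hWsupp ha
  -- the blocks of the window
  let bmap : Fin M → Fin a → Fin n := fun e i => ⟨(e : ℕ) * a + i, hblock_lt e i e.isLt i.isLt⟩
  have hbmap : ∀ e e' i i', bmap e i = bmap e' i' → e = e' ∧ i = i' := by
    intro e e' i i' h
    have h' : (e : ℕ) * a + i = (e' : ℕ) * a + i' := congrArg Fin.val h
    have he : (e : ℕ) = e' := by
      have := congrArg (· / a) h'
      simpa only [blk_div' ha i.isLt, blk_div' ha i'.isLt] using this
    have hi : (i : ℕ) = i' := by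
      have := congrArg (· % a) h'
      simpa only [blk_mod' i.isLt, blk_mod' i'.isLt] using this
    exact ⟨Fin.ext he, Fin.ext hi⟩
  -- ### the homogeneous system `L(F) = 0` on the window; its span is the restriction of `W`
  let Ψ : AffSys (Fin n) := F.image fun e => (formWinF n e.1, (0 : ZMod 2))
  let restr : (ℕ → ZMod 2) →ₗ[ZMod 2] (Fin n → ZMod 2) :=
    LinearMap.funLeft (ZMod 2) (ZMod 2) (Fin.val : Fin n → ℕ)
  have hrestr : ∀ (w : ℕ → ZMod 2) (v : Fin n), restr w v = w v := fun w v => rfl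
  have hrestr_form : ∀ e : LinLit, restr (linFormVec e.1) = formWinF n e.1 := by
    intro e; funext v; simp [restr, LinearMap.funLeft_apply, linFormVec_apply, formWinF]
  have hspan : AffSys.spanS Ψ = W.map restr := by
    apply le_antisymm
    · unfold AffSys.spanS
      rw [Submodule.span_le]
      intro w hw
      rw [Finset.mem_coe] at hw
      unfold AffSys.forms at hw
      rw [Finset.mem_image] at hw
      obtain ⟨q, hq, rfl⟩ := hw
      obtain ⟨e, he, rfl⟩ := Finset.mem_image.1 hq
      refine ⟨linFormVec e.1, ?_, hrestr_form e⟩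
      rw [hW]
      exact Submodule.subset_span (LinClause.mem_forms_iff.2 ⟨e, he, rfl⟩)
    · rw [Submodule.map_le_iff_le_comap, hW, Submodule.span_le]
      intro u hu
      obtain ⟨e, he, rfl⟩ := LinClause.mem_forms_iff.1 hu
      rw [SetLike.mem_coe, Submodule.mem_comap, hrestr_form e]
      apply AffSys.mem_spanS_of_mem_forms
      unfold AffSys.forms
      exact Finset.mem_image.2 ⟨(formWinF n e.1, 0), Finset.mem_image.2 ⟨e, he, rfl⟩, rfl⟩
  -- `restr` is injective on `W`
  have hinj : ∀ w ∈ W, restr w = 0 → w = 0 := by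
    intro w hw h0
    funext v
    by_cases hv : v < n
    · have := congrFun h0 ⟨v, hv⟩
      rw [hrestr] at this
      exact this
    · exact hWn w hw v (by omega)
  -- ### the block rank on the window equals `gRank` on `ℕ`
  let U : Finset (Fin M) → Finset (Fin n) := fun R => R.biUnion fun e => Finset.univ.image (bmap e)
  have hmemU : ∀ (R : Finset (Fin M)) (v : Fin n), v ∈ U R ↔ (v : ℕ) / a ∈ R.image Fin.val := by
    intro R v
    simp only [U, Finset.mem_biUnion, Finset.mem_image, Finset.mem_univ, true_and]
    constructor
    · rintro ⟨e, he, i, hi⟩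
      refine ⟨e, he, ?_⟩
      have := congrArg Fin.val hi
      simp only [bmap] at this
      rw [← this, blk_div' ha i.isLt]
    · rintro ⟨e, he, hev⟩
      refine ⟨e, he, ⟨(v : ℕ) % a, Nat.mod_lt _ ha⟩, Fin.ext ?_⟩
      simp only [bmap]
      have := Nat.div_add_mod' (v : ℕ) a
      rw [hev]
      exact this
  have hZf : ∀ R : Finset (Fin M),
      (Finset.univ \ (Finset.univ \ R).biUnion fun e => Finset.univ.image (bmap e)) = U R := by
    intro R
    ext v
    have hL : v ∈ (Finset.univ \ (Finset.univ \ R).biUnion fun e => Finset.univ.image (bmap e)) ↔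
        (v : ℕ) / a ∉ (Finset.univ \ R).image Fin.val := by
      rw [Finset.mem_sdiff, hmemU (Finset.univ \ R) v]
      simp
    rw [hL, hmemU R v]
    have hva : (v : ℕ) / a < M := by
      rw [Nat.div_lt_iff_lt_mul ha]; exact v.isLt
    constructor
    · intro h
      rw [Finset.mem_image]
      refine ⟨⟨(v : ℕ) / a, hva⟩, ?_, rfl⟩
      by_contra hR
      exact h (Finset.mem_image.2 ⟨⟨(v : ℕ) / a, hva⟩, Finset.mem_sdiff.2 ⟨Finset.mem_univ _, hR⟩, rfl⟩)
    · intro h h'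
      rw [Finset.mem_image] at h h'
      obtain ⟨e, he, hev⟩ := h
      obtain ⟨e', he', hev'⟩ := h'
      rw [Finset.mem_sdiff] at he'
      apply he'.2
      have : e' = e := Fin.ext (by rw [hev, hev'])
      rw [this]; exact he
  have hdim : ∀ R : Finset (Fin M),
      finrank (ZMod 2) (AffSys.spanS Ψ ⊓ AffSys.coordS (U R) : Submodule (ZMod 2) (Fin n → ZMod 2)) =
        gRank a W (R.image Fin.val) := by
    intro R
    set P : Submodule (ZMod 2) (ℕ → ZMod 2) := W ⊓ coordSub (blockVars a (R.image Fin.val)) with hP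
    -- `P.map restr = spanS Ψ ⊓ coordS (U R)`
    have hmap : P.map restr = AffSys.spanS Ψ ⊓ AffSys.coordS (U R) := by
      apply le_antisymm
      · rintro y ⟨w, hw, rfl⟩
        obtain ⟨hwW, hwC⟩ := Submodule.mem_inf.1 hw
        refine Submodule.mem_inf.2 ⟨hspan ▸ Submodule.mem_map_of_mem hwW, ?_⟩
        rw [AffSys.mem_coordS]
        intro v hv
        rw [hrestr]
        apply hwC
        rw [mem_blockVars ha]
        rwa [hmemU] at hv
      · intro y hy
        obtain ⟨hyS, hyC⟩ := Submodule.mem_inf.1 hy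
        rw [hspan] at hyS
        obtain ⟨w, hwW, rfl⟩ := hyS
        refine ⟨w, Submodule.mem_inf.2 ⟨hwW, ?_⟩, rfl⟩
        intro v hv
        by_cases hvn : v < n
        · have h1 := (AffSys.mem_coordS.1 hyC) ⟨v, hvn⟩ (by
            rw [hmemU]; rwa [mem_blockVars ha] at hv)
          rwa [hrestr] at h1
        · exact hWn w hwW v (by omega)
    -- `restr` is injective on `P ≤ W`
    have hinjP : Function.Injective (restr.domRestrict P) := by
      intro x y hxy
      apply Subtype.ext
      have h0 : restr (x.1 - y.1) = 0 := by
        rw [map_sub, sub_eq_zero]; exact hxy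
      have := hinj (x.1 - y.1) (W.sub_mem (Submodule.mem_inf.1 x.2).1 (Submodule.mem_inf.1 y.2).1) h0
      exact sub_eq_zero.1 this
    have hr := LinearMap.finrank_range_of_inj hinjP
    rw [LinearMap.range_domRestrict, hmap] at hr
    unfold gRank
    rw [← hP]
    exact hr
  -- ### maximality transported to the window
  let Q₀ : Finset (Fin M) := Finset.univ.filter fun e => (e : ℕ) ∈ Q
  have hQ₀ : Q₀.image Fin.val = Q := by
    ext x
    simp only [Q₀, Finset.mem_image, Finset.mem_filter, Finset.mem_univ, true_and]
    constructor
    · rintro ⟨e, he, rfl⟩; exact he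
    · intro hx
      exact ⟨⟨x, Finset.mem_range.1 (hQM hx)⟩, hx, rfl⟩
  have hmax : ∀ R : Finset (Fin M),
      (finrank (ZMod 2) (AffSys.spanS Ψ ⊓ AffSys.coordS (Finset.univ \ (Finset.univ \ R).biUnion
          fun e => Finset.univ.image (bmap e)) : Submodule (ZMod 2) (Fin n → ZMod 2)) : ℤ) - (R.card : ℤ) ≤
      (finrank (ZMod 2) (AffSys.spanS Ψ ⊓ AffSys.coordS (Finset.univ \ (Finset.univ \ Q₀).biUnion
          fun e => Finset.univ.image (bmap e)) : Submodule (ZMod 2) (Fin n → ZMod 2)) : ℤ) - (Q₀.card : ℤ) := by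
    intro R
    rw [hZf R, hZf Q₀, hdim R, hdim Q₀, hQ₀]
    have h1 : (R.image Fin.val).card = R.card := Finset.card_image_of_injective _ Fin.val_injective
    have h2 : (Q₀.image Fin.val).card = Q₀.card := Finset.card_image_of_injective _ Fin.val_injective
    rw [hQ₀] at h2
    have := hQ (R.image Fin.val)
    simp only [deficiency_def] at this
    rw [h1] at this
    rw [← h2]
    exact this
  -- ### freeness on the window
  obtain ⟨p₀, hprod⟩ := AffSys.exists_free_of_isMax ha bmap hbmap Ψ Q₀ hmax
  let p : ℕ → Fin a := fun x => if h : x < M then p₀ ⟨x, h⟩ else ⟨0, ha⟩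
  refine ⟨p, ?_⟩
  intro σ τ
  let t : Fin M → Fin a → ZMod 2 := fun e i =>
    (if τ ((e : ℕ) * a + i) = true then 1 else 0) - zOf σ ((e : ℕ) * a + i)
  have h0 : (0 : Fin n → ZMod 2) ∈ AffSys.Sol Ψ := by
    rw [AffSys.mem_Sol]
    intro q hq
    obtain ⟨e, -, rfl⟩ := Finset.mem_image.1 hq
    simp
  obtain ⟨β, hβ, hagree, hfreeβ⟩ := hprod 0 h0 t
  -- the modified assignment: `σ ⊕ β` on the window, `τ` past the window
  let σ' : ℕ → Bool := fun v =>
    if h : v < n then xor (σ v) (decide (β ⟨v, h⟩ = 1)) else τ v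
  have hσ'_in : ∀ (v : ℕ) (h : v < n), zOf σ' v = zOf σ v + β ⟨v, h⟩ := by
    intro v h
    have hcase : ∀ (s : Bool) (r : ZMod 2),
        (if xor s (decide (r = 1)) = true then (1 : ZMod 2) else 0) =
          (if s = true then 1 else 0) + r := by decide
    simp only [zOf_apply, σ', h, dif_pos]
    exact hcase (σ v) (β ⟨v, h⟩)
  refine ⟨σ', ?_, ?_, ?_⟩
  · -- (A) the forms of `F` keep their values
    intro e he b
    apply linLit_eval_eq_of_sum_eq
    have hsum : ∑ i ∈ e.1, zOf σ' i = ∑ i ∈ e.1, (zOf σ i + extWinF n β i) := by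
      refine Finset.sum_congr rfl fun i hi => ?_
      have hin := hvarn e he i hi
      rw [hσ'_in i hin]
      simp [extWinF, hin]
    rw [hsum, Finset.sum_add_distrib, add_eq_left]
    have hβe : formWinF n e.1 ⬝ᵥ β = 0 :=
      AffSys.mem_Sol.1 hβ (formWinF n e.1, 0) (Finset.mem_image_of_mem _ he)
    have hext : (fun v : Fin n => extWinF n β v) = β := by
      funext v; simp [extWinF, v.isLt]
    rw [← formWinF_dotProduct (hvarn e he) (extWinF n β), hext, hβe]
  · -- (B) the blocks of `Q` are untouched
    intro x hx j
    have hxM : x < M := Finset.mem_range.1 (hQM hx)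
    let e : Fin M := ⟨x, hxM⟩
    have heQ : e ∈ Q₀ := by simp [Q₀, e, hx]
    have hin : x * a + j < n := hblock_lt x j hxM j.isLt
    have hβ0 : β ⟨x * a + j, hin⟩ = 0 := by
      have h1 := hagree (bmap e j) (fun e' he' i' h => he' ((hbmap e' e i' j h).1 ▸ heQ))
      simpa using h1
    have h2 : zOf σ' (x * a + j) = zOf σ (x * a + j) := by
      rw [hσ'_in _ hin, hβ0, add_zero]
    have hcase : ∀ s s' : Bool,
        (if s' = true then (1 : ZMod 2) else 0) = (if s = true then 1 else 0) → s' = s := by decide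
    exact hcase _ _ (by simpa only [zOf_apply] using h2)
  · -- (C) outside `Q` the non-pivot positions carry the targets
    intro x hx j hj
    by_cases hxM : x < M
    · let e : Fin M := ⟨x, hxM⟩
      have heQ : e ∉ Q₀ := by simp [Q₀, e, hx]
      have hpe : p x = p₀ e := by simp [p, hxM, e]
      have hj' : j ≠ p₀ e := by rw [← hpe]; exact hj
      have hin : x * a + j < n := hblock_lt x j hxM j.isLt
      have hβj : β ⟨x * a + j, hin⟩ = t e j := hfreeβ e heQ j hj'
      have h2 : zOf σ' (x * a + j) = if τ (x * a + j) = true then 1 else 0 := by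
        rw [hσ'_in _ hin, hβj]
        simp only [t, e]
        ring
      have hcase : ∀ s s' : Bool,
          (if s' = true then (1 : ZMod 2) else 0) = (if s = true then 1 else 0) → s' = s := by decide
      exact hcase _ _ (by simpa only [zOf_apply] using h2)
    · have hge : ¬ x * a + (j : ℕ) < n := by
        intro hlt
        apply hxM
        by_contra hge
        have : M * a ≤ x * a := Nat.mul_le_mul_right a (Nat.le_of_not_lt hge)
        omega
      simp [σ', hge]

/-- **The canonical closure is a block closure in pivot form**: for every system `F` there are
pivots `p` with `BlockFree a F (canClosure a ⟨L(F)⟩) p`. [Efremenko–Garlík–Itsykson 2024, §4;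
Alekseev–Itsykson 2025, Lemma 2.9] [cite: EfremenkoGarlikItsykson2024, Thm 3.1] -/
theorem exists_blockFree_canClosure {a : ℕ} (ha : 0 < a) (F : Finset LinLit) :
    ∃ p : ℕ → Fin a, BlockFree a F (canClosure a (Submodule.span (ZMod 2) (LinClause.forms F))) p := by
  classical
  set M : ℕ := (F.biUnion (fun e => e.1)).sup (fun v => v / a) + 1 with hM
  have hvar : ∀ e ∈ F, ∀ v ∈ e.1, v < M * a := by
    intro e he v hv
    have h1 : v / a < M :=
      Nat.lt_succ_of_le (Finset.le_sup (f := fun v => v / a) (Finset.mem_biUnion.2 ⟨e, he, hv⟩))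
    rwa [Nat.div_lt_iff_lt_mul ha] at h1
  haveI : Module.Finite (ZMod 2) (Submodule.span (ZMod 2) (LinClause.forms F)) :=
    Module.Finite.span_of_finite (ZMod 2) (Set.finite_range _)
  exact blockFree_of_isMaxDef ha F (isMaxDef_canClosure (span_forms_le_coordSub ha hvar) ha)

end Literature.Computability.MetaComplexity
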